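import Literature.NumberTheory.EllipticCurves.ComplexMultiplicationLocalFactorsAux
import Literature.NumberTheory.EllipticCurves.TwoIsogenyPointCount
import Literature.NumberTheory.EllipticCurves.IsogenyCompProofs
import HarnessLib

/-!
# Equal `L`-functions across the CM isogeny class `j = 54000 ~ j = 0` and all its twists

Sibling file of `Literature.NumberTheory.EllipticCurves.ComplexMultiplication` (D-0014 append
protocol; everything here is proved). The curve `E : y² = x³ + 6x² - 3x` (`j = 54000 = 2⁴3³5³`,
CM by the order `ℤ[√-3]` of conductor `2` in `ℚ(√-3)`) is `2`-isogenous over `ℚ` to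
`y² = x³ - 3x² + 3x = (x - 1)³ + 1` (`j = 0`, CM by `ℤ[ζ₃]`) (Silverman, *AEC*, III.4.5; the
tree's `isIsogenous_cm12`), and likewise for all quadratic twists. As in
`ComplexMultiplicationLocalFactors16` (the class `j = 287496`) we prove the corresponding instance of Knapp's
Theorem 11.67 (*Elliptic Curves*, p. 281; the named fact `Literature.NumberTheory.EllipticCurves.LFunction_eq_of_isIsogenous`)
prime by prime for Mathlib's `WeierstrassCurve.LFunction`:

`L(E_d, s) = L(E'_d, s)` for `E_d = [0, 6d, 0, -3d², 0]`, `E'_d = [0, -3d, 0, 3d², 0]`, every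
squarefree integer `d ≠ 0` (`WeierstrassCurve.LFunction_cm12_eq`).

* `p ∣ 6d`: both curves have additive reduction (`Δ(E_d) = 2⁸3³d⁶`, `c₄(E_d) = 720d²`;
  `Δ(E'_d) = -2⁴3³d⁶`, `c₄(E'_d) = 0`: in every case `ord_p(Δ) ∈ {3, 4, 6, 8, 9, 10, 14}` is not
  a multiple of `12` and `ord_p(j) ≥ 0`; `hasAdditiveReductionAt_map_of_data`), local factors `1`.
* `p ∤ 6d`: good reduction of both models, and `#E_d(𝔽_p) = #E'_d(𝔽_p)` by the explicit
  `2`-isogeny over `𝔽_p` and the prime-degree torsor lemma (`natCard_point_twoTorsionNF_eq`;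
  `E'_d = ⟨2, 0, 0, 0⟩ • [0, -12d, 0, 48d², 0]` over `𝔽_p`) — Knapp's "`#E_p = #E'_p`".

## References

* A. W. Knapp, *Elliptic Curves* (1992), Thm. 11.67 and its sketch of proof (PDF pp. 281–282).
  [cite: Knapp1993]
* J. H. Silverman, *The Arithmetic of Elliptic Curves*, 2nd ed. (2009), III.4.5, VII.5.1, §C.16,
  Exercise 5.4(a). [cite: SilvermanAEC2009]
* J. H. Silverman, *Advanced Topics* (1994), App. A §3 (`D = -3`, `f = 2`, `j = 54000 = 2⁴3³5³`).
  [cite: SilvermanAdvancedTopics1994, App. A §3]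
-/

noncomputable section

open scoped Classical

open IsDedekindDomain NumberField Rat.HeightOneSpectrum Polynomial

namespace WeierstrassCurve

/-! ## The models -/

/-- The twist family of `y² = x³ + 6x² - 3x` (`j = 54000`): `E_d = [0, 6d, 0, -3d², 0]`.
Silverman, *Advanced Topics*, App. A §3 (`D = -3`, `f = 2`). [folklore] -/
def cm12Model (d : ℤ) : WeierstrassCurve ℤ :=
  ⟨0, 6 * d, 0, -3 * d ^ 2, 0⟩

/-- The twist family of `y² = x³ - 3x² + 3x` (`j = 0`), the `2`-isogenous partner of
`cm12Model d` (the `2`-isogeny codomain `[0, -12d, 0, 48d², 0]` rescaled by `u = 2`):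
`E'_d = [0, -3d, 0, 3d², 0]`. [folklore] -/
def cm12Codomain (d : ℤ) : WeierstrassCurve ℤ :=
  ⟨0, -3 * d, 0, 3 * d ^ 2, 0⟩

section Invariants

variable (d : ℤ)

/-- `E_d` base-changed along `ℤ → R`. [folklore] -/
@[simp] theorem map_cm12Model {R : Type*} [CommRing R] (f : ℤ →+* R) :
    (cm12Model d).map f = ⟨0, 6 * (d : R), 0, -3 * (d : R) ^ 2, 0⟩ := by
  simp [cm12Model, WeierstrassCurve.map]

/-- `E'_d` base-changed along `ℤ → R`. [folklore] -/
@[simp] theorem map_cm12Codomain {R : Type*} [CommRing R] (f : ℤ →+* R) :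
    (cm12Codomain d).map f = ⟨0, -3 * (d : R), 0, 3 * (d : R) ^ 2, 0⟩ := by
  simp [cm12Codomain, WeierstrassCurve.map]

/-- `Δ(E_d) = 2⁸3³ d⁶`. [folklore] -/
theorem cm12Model_Δ : (cm12Model d).Δ = 2 ^ 8 * 3 ^ 3 * d ^ 6 := by
  simp only [cm12Model, Δ, b₂, b₄, b₆, b₈]; ring

/-- `c₄(E_d) = 720 d²`. [folklore] -/
theorem cm12Model_c₄ : (cm12Model d).c₄ = 720 * d ^ 2 := by
  simp only [cm12Model, c₄, b₂, b₄]; ring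

/-- `Δ(E'_d) = -2⁴3³ d⁶`. [folklore] -/
theorem cm12Codomain_Δ : (cm12Codomain d).Δ = -(2 ^ 4 * 3 ^ 3 * d ^ 6) := by
  simp only [cm12Codomain, Δ, b₂, b₄, b₆, b₈]; ring

/-- `c₄(E'_d) = 0` (`j = 0`). [folklore] -/
theorem cm12Codomain_c₄ : (cm12Codomain d).c₄ = 0 := by
  simp only [cm12Codomain, c₄, b₂, b₄]; ring

end Invariants

/-! ## The additive places `p ∣ 6d` -/

section Additive

variable (v : HeightOneSpectrum (𝓞 ℚ)) {d : ℤ}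

/-- **`E_d` has additive reduction at every `p ∣ 6d`** (`d` squarefree): `Δ = 2⁸3³d⁶`,
`c₄ = 720 d² = 2⁴3²5 d²`, so `ord_p(Δ) ∈ {3, 6, 8, 9, 14}` and `3 ord_p(c₄) ≥ ord_p(Δ)`.
[cite: SilvermanAEC2009, VII.5 Prop. 5.1(c)] -/
theorem hasAdditiveReductionAt_cm12Model (hsq : Squarefree d)
    (hv : (natGenerator v : ℤ) ∣ 6 * d) :
    ((cm12Model d).map (Int.castRingHom ℚ)).HasAdditiveReductionAt v := by
  have hpZ := Rat.prime_natGenerator_int v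
  by_cases hpd : (natGenerator v : ℤ) ∣ d
  · obtain ⟨d₀, rfl, hd₀⟩ := Int.exists_eq_mul_not_dvd_of_squarefree hpZ hsq hpd
    have hd6 : ¬ ((natGenerator v : ℕ) : ℤ) ∣ d₀ ^ 6 := fun h ↦ hd₀ (hpZ.dvd_of_dvd_pow h)
    by_cases hp2 : natGenerator v = 2
    · -- `2 ∣ d`: `Δ = 2¹⁴ (27 d₀⁶)`, `c₄ = 2⁶ (45 d₀²)`
      have hm : ¬ ((natGenerator v : ℕ) : ℤ) ∣ 27 * d₀ ^ 6 := fun h ↦ by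
        rcases hpZ.dvd_or_dvd h with h | h
        · rw [hp2] at h; norm_num at h
        · exact hd6 h
      refine hasAdditiveReductionAt_map_of_data v _ (n := 14) (e := 6) (m := 27 * d₀ ^ 6)
        (k := 45 * d₀ ^ 2) ?_ hm (by decide) ?_ (by norm_num)
      · rw [cm12Model_Δ, hp2]; push_cast; ring
      · rw [cm12Model_c₄, hp2]; push_cast; ring
    by_cases hp3 : natGenerator v = 3
    · -- `3 ∣ d`: `Δ = 3⁹ (256 d₀⁶)`, `c₄ = 3⁴ (80 d₀²)`
      have hm : ¬ ((natGenerator v : ℕ) : ℤ) ∣ 256 * d₀ ^ 6 := fun h ↦ by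
        rcases hpZ.dvd_or_dvd h with h | h
        · rw [hp3] at h; norm_num at h
        · exact hd6 h
      refine hasAdditiveReductionAt_map_of_data v _ (n := 9) (e := 4) (m := 256 * d₀ ^ 6)
        (k := 80 * d₀ ^ 2) ?_ hm (by decide) ?_ (by norm_num)
      · rw [cm12Model_Δ, hp3]; push_cast; ring
      · rw [cm12Model_c₄, hp3]; push_cast; ring
    · -- `p ≥ 5`, `p ∣ d`: `Δ = p⁶ (6912 d₀⁶)`, `c₄ = p² (720 d₀²)`
      have hm : ¬ ((natGenerator v : ℕ) : ℤ) ∣ 2 ^ 8 * 3 ^ 3 * d₀ ^ 6 := fun h ↦ by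
        rcases hpZ.dvd_or_dvd h with h | h
        · rcases hpZ.dvd_or_dvd h with h | h
          · exact Rat.not_natGenerator_dvd_of_ne v Nat.prime_two hp2 (hpZ.dvd_of_dvd_pow h)
          · exact Rat.not_natGenerator_dvd_of_ne v Nat.prime_three hp3 (hpZ.dvd_of_dvd_pow h)
        · exact hd6 h
      refine hasAdditiveReductionAt_map_of_data v _ (n := 6) (e := 2) (m := 2 ^ 8 * 3 ^ 3 * d₀ ^ 6)
        (k := 720 * d₀ ^ 2) ?_ hm (by decide) ?_ (by norm_num)
      · rw [cm12Model_Δ]; ring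
      · rw [cm12Model_c₄]; ring
  · have hd6 : ¬ ((natGenerator v : ℕ) : ℤ) ∣ d ^ 6 := fun h ↦ hpd (hpZ.dvd_of_dvd_pow h)
    rcases dvd_or_eq_two_or_eq_three v hv with h | hp2 | hp3
    · exact absurd h hpd
    · -- `p = 2 ∤ d`: `Δ = 2⁸ (27 d⁶)`, `c₄ = 2⁴ (45 d²)`
      have hm : ¬ ((natGenerator v : ℕ) : ℤ) ∣ 27 * d ^ 6 := fun h ↦ by
        rcases hpZ.dvd_or_dvd h with h | h
        · rw [hp2] at h; norm_num at h
        · exact hd6 h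
      refine hasAdditiveReductionAt_map_of_data v _ (n := 8) (e := 4) (m := 27 * d ^ 6)
        (k := 45 * d ^ 2) ?_ hm (by decide) ?_ (by norm_num)
      · rw [cm12Model_Δ, hp2]; push_cast; ring
      · rw [cm12Model_c₄, hp2]; push_cast; ring
    · -- `p = 3 ∤ d`: `Δ = 3³ (256 d⁶)`, `c₄ = 3² (80 d²)`
      have hm : ¬ ((natGenerator v : ℕ) : ℤ) ∣ 256 * d ^ 6 := fun h ↦ by
        rcases hpZ.dvd_or_dvd h with h | h
        · rw [hp3] at h; norm_num at h
        · exact hd6 h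
      refine hasAdditiveReductionAt_map_of_data v _ (n := 3) (e := 2) (m := 256 * d ^ 6)
        (k := 80 * d ^ 2) ?_ hm (by decide) ?_ (by norm_num)
      · rw [cm12Model_Δ, hp3]; push_cast; ring
      · rw [cm12Model_c₄, hp3]; push_cast; ring

/-- **`E'_d` has additive reduction at every `p ∣ 6d`** (`d` squarefree): `Δ = -2⁴3³d⁶`,
`c₄ = 0`, so `ord_p(Δ) ∈ {3, 4, 6, 9, 10}` and the `j`-condition is void.
[cite: SilvermanAEC2009, VII.5 Prop. 5.1(c)] -/
theorem hasAdditiveReductionAt_cm12Codomain (hsq : Squarefree d)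
    (hv : (natGenerator v : ℤ) ∣ 6 * d) :
    ((cm12Codomain d).map (Int.castRingHom ℚ)).HasAdditiveReductionAt v := by
  have hpZ := Rat.prime_natGenerator_int v
  -- with `c₄ = 0` the `j`-inequality is trivial; we use `hasAdditiveReductionAt_map_of_Δ_eq`
  have hc : ∀ x : ℚ, v.valuation ℚ (((cm12Codomain d).c₄ : ℤ) : ℚ) ^ 3 ≤ v.valuation ℚ x := by
    intro x; rw [cm12Codomain_c₄]; simp
  by_cases hpd : (natGenerator v : ℤ) ∣ d
  · obtain ⟨d₀, rfl, hd₀⟩ := Int.exists_eq_mul_not_dvd_of_squarefree hpZ hsq hpd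
    have hd6 : ¬ ((natGenerator v : ℕ) : ℤ) ∣ d₀ ^ 6 := fun h ↦ hd₀ (hpZ.dvd_of_dvd_pow h)
    by_cases hp2 : natGenerator v = 2
    · have hm : ¬ ((natGenerator v : ℕ) : ℤ) ∣ -(27 * d₀ ^ 6) := fun h ↦ by
        rw [dvd_neg] at h
        rcases hpZ.dvd_or_dvd h with h | h
        · rw [hp2] at h; norm_num at h
        · exact hd6 h
      refine hasAdditiveReductionAt_map_of_Δ_eq v _ (n := 10) (m := -(27 * d₀ ^ 6)) ?_ hm
        (by decide) (hc _)
      rw [cm12Codomain_Δ, hp2]; push_cast; ring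
    by_cases hp3 : natGenerator v = 3
    · have hm : ¬ ((natGenerator v : ℕ) : ℤ) ∣ -(16 * d₀ ^ 6) := fun h ↦ by
        rw [dvd_neg] at h
        rcases hpZ.dvd_or_dvd h with h | h
        · rw [hp3] at h; norm_num at h
        · exact hd6 h
      refine hasAdditiveReductionAt_map_of_Δ_eq v _ (n := 9) (m := -(16 * d₀ ^ 6)) ?_ hm
        (by decide) (hc _)
      rw [cm12Codomain_Δ, hp3]; push_cast; ring
    · have hm : ¬ ((natGenerator v : ℕ) : ℤ) ∣ -(2 ^ 4 * 3 ^ 3 * d₀ ^ 6) := fun h ↦ by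
        rw [dvd_neg] at h
        rcases hpZ.dvd_or_dvd h with h | h
        · rcases hpZ.dvd_or_dvd h with h | h
          · exact Rat.not_natGenerator_dvd_of_ne v Nat.prime_two hp2 (hpZ.dvd_of_dvd_pow h)
          · exact Rat.not_natGenerator_dvd_of_ne v Nat.prime_three hp3 (hpZ.dvd_of_dvd_pow h)
        · exact hd6 h
      refine hasAdditiveReductionAt_map_of_Δ_eq v _ (n := 6) (m := -(2 ^ 4 * 3 ^ 3 * d₀ ^ 6))
        ?_ hm (by decide) (hc _)
      rw [cm12Codomain_Δ]; ring
  · have hd6 : ¬ ((natGenerator v : ℕ) : ℤ) ∣ d ^ 6 := fun h ↦ hpd (hpZ.dvd_of_dvd_pow h)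
    rcases dvd_or_eq_two_or_eq_three v hv with h | hp2 | hp3
    · exact absurd h hpd
    · have hm : ¬ ((natGenerator v : ℕ) : ℤ) ∣ -(27 * d ^ 6) := fun h ↦ by
        rw [dvd_neg] at h
        rcases hpZ.dvd_or_dvd h with h | h
        · rw [hp2] at h; norm_num at h
        · exact hd6 h
      refine hasAdditiveReductionAt_map_of_Δ_eq v _ (n := 4) (m := -(27 * d ^ 6)) ?_ hm
        (by decide) (hc _)
      rw [cm12Codomain_Δ, hp2]; push_cast; ring
    · have hm : ¬ ((natGenerator v : ℕ) : ℤ) ∣ -(16 * d ^ 6) := fun h ↦ by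
        rw [dvd_neg] at h
        rcases hpZ.dvd_or_dvd h with h | h
        · rw [hp3] at h; norm_num at h
        · exact hd6 h
      refine hasAdditiveReductionAt_map_of_Δ_eq v _ (n := 3) (m := -(16 * d ^ 6)) ?_ hm
        (by decide) (hc _)
      rw [cm12Codomain_Δ, hp3]; push_cast; ring

end Additive

/-! ## The good places `p ∤ 6d` -/

section Good

variable {p : ℕ} [Fact p.Prime] {d : ℤ}

/-- **`#E_d(𝔽_p) = #E'_d(𝔽_p)` for `p ∤ 6d`** (the reductions are `2`-isogenous over `𝔽_p`;
`natCard_point_twoTorsionNF_eq` and `E'_d = ⟨2, 0, 0, 0⟩ • [0, -12d, 0, 48d², 0]`).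
[cite: Knapp1993, proof of Thm. 11.67, (11.89) (PDF p. 282)] -/
theorem natCard_point_cm12_zmod_eq (hpd : ¬ (p : ℤ) ∣ 6 * d) :
    Nat.card ((cm12Model d).map (Int.castRingHom (ZMod p))).toAffine.Point =
      Nat.card ((cm12Codomain d).map (Int.castRingHom (ZMod p))).toAffine.Point := by
  obtain ⟨h2, h3, hd⟩ := two_ne_zero_and_of_not_dvd hpd
  have hE : (cm12Model d).map (Int.castRingHom (ZMod p)) =
      ⟨0, 6 * (d : ZMod p), 0, -3 * (d : ZMod p) ^ 2, 0⟩ := map_cm12Model d _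
  haveI : (⟨0, 6 * (d : ZMod p), 0, -3 * (d : ZMod p) ^ 2, 0⟩ : WeierstrassCurve (ZMod p)).IsElliptic := by
    refine ⟨isUnit_iff_ne_zero.mpr ?_⟩
    rw [← hE, map_Δ, cm12Model_Δ]
    simp only [map_mul, map_pow, eq_intCast, Int.cast_ofNat]
    exact mul_ne_zero (mul_ne_zero (pow_ne_zero _ h2) (pow_ne_zero _ h3)) (pow_ne_zero _ hd)
  have hF : (cm12Codomain d).map (Int.castRingHom (ZMod p)) =
      (⟨Units.mk0 2 h2, 0, 0, 0⟩ : VariableChange (ZMod p)) •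
        ⟨0, -2 * (6 * (d : ZMod p)), 0, (6 * (d : ZMod p)) ^ 2 - 4 * (-3 * (d : ZMod p) ^ 2), 0⟩ := by
    rw [map_cm12Codomain]
    ext
    · simp [variableChange_a₁]
    · simp only [variableChange_a₂, Units.val_inv_eq_inv_val, Units.val_mk0]
      field_simp
      ring
    · simp [variableChange_a₃]
    · simp only [variableChange_a₄, Units.val_inv_eq_inv_val, Units.val_mk0]
      field_simp
      ring
    · simp [variableChange_a₆]
  rw [hE, hF, natCard_point_smul]
  exact natCard_point_twoTorsionNF_eq _ _

end Good

/-! ## Assembly -/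

section Assembly

variable {d : ℤ}

/-- **The local polynomials of `E_d` and `E'_d` agree at every finite place of `ℚ`**
(`d` squarefree, so `d ≠ 0`). [cite: Knapp1993, proof of Thm. 11.67 (PDF pp. 281–282)] -/
theorem localPolynomial_cm12_eq (hsq : Squarefree d) (v : HeightOneSpectrum (𝓞 ℚ)) :
    (((cm12Model d).map (Int.castRingHom ℚ)).baseChange (v.adicCompletion ℚ)).localPolynomial
        (v.adicCompletionIntegers ℚ) =
      (((cm12Codomain d).map (Int.castRingHom ℚ)).baseChange (v.adicCompletion ℚ)).localPolynomial
        (v.adicCompletionIntegers ℚ) := by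
  by_cases hv : (natGenerator v : ℤ) ∣ 6 * d
  · exact localPolynomial_eq_of_hasAdditiveReductionAt v
      (hasAdditiveReductionAt_cm12Model v hsq hv) (hasAdditiveReductionAt_cm12Codomain v hsq hv)
  · haveI := Fact.mk (prime_natGenerator v)
    have hpZ := Rat.prime_natGenerator_int v
    have hdvd : ∀ k l : ℕ, ¬ (natGenerator v : ℤ) ∣ 2 ^ k * 3 ^ l * d ^ 6 := fun k l h ↦ by
      rcases hpZ.dvd_or_dvd h with h | h
      · rcases hpZ.dvd_or_dvd h with h | h
        · exact hv ((hpZ.dvd_of_dvd_pow h).trans ⟨3 * d, by ring⟩)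
        · exact hv ((hpZ.dvd_of_dvd_pow h).trans ⟨2 * d, by ring⟩)
      · exact hv ((hpZ.dvd_of_dvd_pow h).mul_left 6)
    refine localPolynomial_map_eq_of_natCard_eq v _ _ ?_ ?_ (natCard_point_cm12_zmod_eq hv)
    · rw [cm12Model_Δ]; exact hdvd 8 3
    · rw [cm12Codomain_Δ, dvd_neg]; exact hdvd 4 3

/-- **`L(E_d, s) = L(E'_d, s)`** for the `2`-isogenous CM curves `E_d = [0, 6d, 0, -3d², 0]`
(`j = 54000`) and `E'_d = [0, -3d, 0, 3d², 0]` (`j = 0`), every squarefree `d ≠ 0`: Knapp's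
Theorem 11.67 for this isogeny class, for Mathlib's `WeierstrassCurve.LFunction`.
[cite: Knapp1993, Thm. 11.67 (PDF p. 281)] -/
theorem LFunction_cm12_eq (hsq : Squarefree d) :
    ((cm12Model d).map (Int.castRingHom ℚ)).LFunction =
      ((cm12Codomain d).map (Int.castRingHom ℚ)).LFunction :=
  LFunction_eq_of_forall_localPolynomial_eq (localPolynomial_cm12_eq hsq)

/-- `E_d ~ E'_d` over `ℚ` (Silverman III.4.5). [cite: SilvermanAEC2009, III.4 Example 4.5] -/
theorem isIsogenous_cm12Model (hd : d ≠ 0) :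
    IsIsogenous ((cm12Model d).map (Int.castRingHom ℚ)) ((cm12Codomain d).map (Int.castRingHom ℚ)) := by
  have hE : (cm12Model d).map (Int.castRingHom ℚ) = ⟨0, 6 * (d : ℚ), 0, -3 * (d : ℚ) ^ 2, 0⟩ :=
    map_cm12Model d _
  haveI : (⟨0, 6 * (d : ℚ), 0, -3 * (d : ℚ) ^ 2, 0⟩ : WeierstrassCurve ℚ).IsElliptic := by
    refine ⟨isUnit_iff_ne_zero.mpr ?_⟩
    rw [← hE, map_Δ, cm12Model_Δ]
    simp only [map_mul, map_pow, eq_intCast, Int.cast_ofNat]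
    exact mul_ne_zero (by norm_num) (pow_ne_zero _ (Int.cast_ne_zero.mpr hd))
  have hF : (cm12Codomain d).map (Int.castRingHom ℚ) =
      (⟨Units.mk0 2 two_ne_zero, 0, 0, 0⟩ : VariableChange ℚ) •
        (⟨0, 6 * (d : ℚ), 0, -3 * (d : ℚ) ^ 2, 0⟩ : WeierstrassCurve ℚ).twoIsogenyCodomain := by
    rw [map_cm12Codomain]
    ext
    · simp [variableChange_a₁, twoIsogenyCodomain]
    · simp only [variableChange_a₂, twoIsogenyCodomain, Units.val_inv_eq_inv_val, Units.val_mk0]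
      field_simp
      ring
    · simp [variableChange_a₃, twoIsogenyCodomain]
    · simp only [variableChange_a₄, twoIsogenyCodomain, Units.val_inv_eq_inv_val, Units.val_mk0]
      field_simp
      ring
    · simp [variableChange_a₆, twoIsogenyCodomain]
  rw [hE, hF]
  exact IsIsogenous.trans' (isIsogenous_twoIsogenyCodomain _) (isIsogenous_smul _ _)

/-- **Knapp 11.67 for the class `j = 54000 ~ 0`, in the form consumed by the CM reductions**.
[cite: Knapp1993, Thm. 11.67] -/
theorem isIsogenous_and_LFunction_eq_cm12 (hd : d ≠ 0) (hsq : Squarefree d) :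
    IsIsogenous ((cm12Model d).map (Int.castRingHom ℚ)) ((cm12Codomain d).map (Int.castRingHom ℚ)) ∧
      ((cm12Model d).map (Int.castRingHom ℚ)).LFunction =
        ((cm12Codomain d).map (Int.castRingHom ℚ)).LFunction :=
  ⟨isIsogenous_cm12Model hd, LFunction_cm12_eq hsq⟩

end Assembly

end WeierstrassCurve
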